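import Summits.QuantumFields.YangMills.Theorems.BalabanUVNodesPortS1FEStepUc
import Summits.QuantumFields.YangMills.Theorems.BalabanUVNodesPortS1LZdetGermMem
import Literature.MathematicalPhysics.QuantumFieldTheory.Balaban1983to89.TorusHypercubicSymmetry

/-!
# BalabanUVNodes — port (S1): THE REGULARITY LETTER `CutsInUcNear` IS A THEOREM — near `B = 0` every CUT (1.9) pair of the charted configuration `(U_{k+1}(W_B), J(U_{k+1}(W_B)))` lies in
  `U^c_{k+1}(X, α₀, α₁)` of record for EVERY domain `X` (porter hand `hand-27930-FE-1` g0, cell `ym-nodeO-ideate`; ◇ lens-1 g14 `LENS-1-NODE-v20` R1∕Z1b «germ ⇐ domain-wide by continuity at W₀ = 1»)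

`--supports stmt-QuantumFields-27930` (helper; NO `--workitem`); count-neutral.  [I] = [Balaban1987RG1]; [15] = [Balaban1985Variational].

WHY.  ✓`…PortS1FEStepUc.portRecordFEHalfBox_of_uc` derives the registered `stub_FE` type from THREE letters of the domain-wide currency: the LZ half (Uc), the FE step (Uc) and the regularity letter
`CutsInUcNear` (the charted data near `B = 0` lie in the domains).  The third is continuity bookkeeping over the ⁸ antecedent's own row `hP9` (analyticity of `B ↦ U_{k+1}(W_B)` at `0`), and the
porter lineage already proved the UNCUT version (✓`…PortS1LZdetGermMem.eventually_encodeCfg_recordPairJ_mem_recordUc`).  THIS FILE proves the CUT version — the cut pair has bond matrices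
`U_{k+1}(W_B)(b)` on the bonds of `X` and `1` off them, currents `J(b)` on `X` and `0` off — by the same device (✓`satisfies_recordPair`: a near-unit `SU(2)`-valued `𝐔` with small plaquettes INSIDE
`X` and a small traceless `𝐉` satisfies (i)–(iv) of record), observing that a plaquette inside `X` reads only bonds of `X`, where the cut field IS the field:
* `plaq_cut_eq_of_mem_plaqInside` — for `p` with its four corners in the site set of `X`, the plaquette of the cut field is that of the field;
* ★★ `eventually_cutsInUc` — `∀ᶠ B in 𝓝 0, CutsInUc F Mc k α₀ α₁ a₀ ε₂₉ n B` from `hP9` at `(k, n, ε₂₉)`, any `0 < α₀`, `0 < α₁`;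
* ★★★ `cutsInUcNear_holds : ∀ F, CutsInUcNear F` — THE LETTER DISCHARGED; hence ★★★ `portRecordFEHalfBox_of_lzUc_stepUc : (∀ F, PortRecordLZHalfUc F) → (∀ F, FEStepUc F) → ∀ F, PortRecordFEHalfBox F`
  — the domain-wide menu for `stub_FE` is down to TWO letters {LZ half (Uc), FE step (Uc)}.
DEDUP: `plaq_cut_eq_of_mem_plaqInside`, `eventually_cutsInUc`, `cutsInUcNear_holds`, `portRecordFEHalfBox_of_lzUc_stepUc` — 0 tree hits (`rg -ow`); everything else IMPORTED by name.

HONEST STATUS.  Continuity bookkeeping over the antecedent's own analyticity row; NOTHING of Bałaban's (2.10)–(2.14), §3–§5 or [II] asserted, ported or discharged; `FEStepUc`, `PortRecordLZHalfUc` OPEN;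
`stub_FE` NOT closed; ⟨27930⟩ OPEN (1∕3); NODE O 0∕1; COUNT 8∕28 · K 1∕4 UNMOVED; finite 𝕋⁴_{L^K} at fixed ε — NOT continuum ∕ OS ∕ Clay; **the Yang–Mills mass gap (Clay) is NOT proved by any of this.**
No `sorry`; standard axioms.

References: T. Bałaban, *Renormalization group approach to lattice gauge field theories. I*, Comm. Math. Phys. 109 (1987) 249–301 [Balaban1987RG1] — (1.11)–(1.16) pp.262–263, (1.9) p.261, (1.1) p.260;
T. Bałaban, *Propagators and renormalization transformations … III* ∕ *variational problem*, Comm. Math. Phys. 102 (1985) 277–309 [Balaban1985Variational] — Prop. 9 p.309.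
-/

noncomputable section

open scoped BigOperators Matrix.Norms.L2Operator Topology
open Filter

namespace Summit.QuantumFields.YangMills.Theorems.BalabanUVNodesPortS1

open Summit.QuantumFields.YangMills.Theorems.K0RecordFormatNames
open Literature.MathematicalPhysics.QuantumFieldTheory.Balaban1983to89
open Literature.MathematicalPhysics.QuantumFieldTheory.Balaban1983to89.Node00
open Literature.MathematicalPhysics.QuantumFieldTheory.Balaban1983to89.T4Continuum (T4Family)

variable (F : T4Family)

/-! ## §1  A plaquette inside `X` reads only bonds of `X` -/

open scoped Classical in
/-- **For a plaquette with its four corners in the site set of `X`, the plaquette variable of a field CUT to the bonds of `X` (value `1` off them) is that of the field.**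
[cite: Balaban1987RG1, (1.11) p.262, (1.7) p.261 (bookkeeping)] -/
theorem plaq_cut_eq_of_mem_plaqInside {M : Type*} [Group M] (Mc k K : ℕ) (X : (recordDomSys F Mc k K).Dom) (U : PBond (F.P K) 0 → M)
    {p : Plaq (F.P K) 0} (hp : p ∈ plaqInside (Sect2.domSites (F.P K) Mc (k + 1) X)) :
    B12RegularSpaces111.plaq (fun b => if b ∈ domBonds F Mc k K X then U b else 1) p = B12RegularSpaces111.plaq U p := by
  obtain ⟨h1, h2, h3, h4⟩ := hp
  have h4' : (p.src.shift p.ν).shift p.μ ∈ Sect2.domSites (F.P K) Mc (k + 1) X := by rw [Site.shift_comm]; exact h4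
  have hb1 : (⟨p.src, p.μ⟩ : PBond (F.P K) 0) ∈ domBonds F Mc k K X := ⟨h1, h2⟩
  have hb2 : (⟨p.src.shift p.μ, p.ν⟩ : PBond (F.P K) 0) ∈ domBonds F Mc k K X := ⟨h2, h4⟩
  have hb3 : (⟨p.src.shift p.ν, p.μ⟩ : PBond (F.P K) 0) ∈ domBonds F Mc k K X := ⟨h3, h4'⟩
  have hb4 : (⟨p.src, p.ν⟩ : PBond (F.P K) 0) ∈ domBonds F Mc k K X := ⟨h1, h3⟩
  rw [B12RegularSpaces111.plaq_eq, B12RegularSpaces111.plaq_eq, if_pos hb1, if_pos hb2, if_pos hb3, if_pos hb4]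

/-! ## §2  ★★ Near `B = 0` the cut pairs lie in the domains -/

open scoped Classical in
/-- ★★ **EVENTUALLY NEAR `B = 0`, EVERY CUT PAIR LIES IN ITS DOMAIN**: from the antecedent's analyticity row `hP9` at `(k, n, ε₂₉)` (⟹ the bond matrices tend to `1`, the plaquette variables
to `1`, the currents to `0` — ✓`eventually_norm_recordBgField_sub_one_lt`, ✓`eventually_norm_plaq_recordBgUnits_sub_one_lt`, ✓`eventually_norm_recordCurrent_lt`) and ✓`satisfies_recordPair` applied
to the CUT pair (`1`∕`0` off `X` only help). [cite: Balaban1987RG1, (1.11)–(1.16) pp.262–263, (1.9) p.261; Balaban1985Variational, Prop. 9 p.309] -/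
theorem eventually_cutsInUc (a₀ ε₂₉ : ℝ) (Mc k n : ℕ)
    (hP9 : letI θ := thetaFill F a₀ ε₂₉; letI := θ.instVβ₁; letI := θ.instVβ₂; letI := θ.instιβ
      AnalyticAt ℝ (fun B : recordW F a₀ ε₂₉ k (recordK₀ F Mc k + n) => fun (b : PBond (F.P (recordK₀ F Mc k + n)) 0) (i i' : Fin 2) =>
        ((recordBgField F θ k (recordK₀ F Mc k + n) B b : SU 2) : Matrix (Fin 2) (Fin 2) ℂ) i i') 0)
    {α₀ α₁ : ℝ} (hα₀ : 0 < α₀) (hα₁ : 0 < α₁) :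
    letI θ := thetaFill F a₀ ε₂₉; letI := θ.instVβ₁; letI := θ.instVβ₂; letI := θ.instιβ
    ∀ᶠ B in 𝓝 (0 : recordW F a₀ ε₂₉ k (recordK₀ F Mc k + n)), CutsInUc F Mc k α₀ α₁ a₀ ε₂₉ n B := by
  letI θ := thetaFill F a₀ ε₂₉; letI := θ.instVβ₁; letI := θ.instVβ₂; letI := θ.instιβ
  set K := recordK₀ F Mc k + n with hKdef
  have hk : k + 1 ≤ (F.P K).m + (F.P K).K := succ_le_m_add_K_recordK₀ F Mc k n
  have hξ : 0 < (F.P K).eta (k + 1) := pow_pos (inv_pos.mpr (Nat.cast_pos.mpr (F.P K).L_pos)) _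
  have hδ : 0 < min (1 / 2) (α₁ * (F.P K).eta (k + 1) ^ 2 / 8) := lt_min (by norm_num) (by positivity)
  filter_upwards [eventually_norm_recordBgField_sub_one_lt F θ hk hP9 hδ, eventually_norm_recordCurrent_lt F θ hk hP9 hα₀,
    eventually_norm_plaq_recordBgUnits_sub_one_lt F θ hk hP9 (by positivity : 0 < α₀ * (F.P K).eta (k + 1) ^ 2)] with B hU hJ hp X
  -- the cut pair as an `SU(2)`-valued field and a current
  set Uc : GaugeField (F.P K) 0 (SU 2) := fun b => if b ∈ domBonds F Mc k K X then recordBgField F θ k K B b else 1 with hUc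
  set Jc : PBond (F.P K) 0 → MatA 2 := fun b => if b ∈ domBonds F Mc k K X then recordCurrent F θ k K B b else 0 with hJc
  have hUnear : ∀ b, ‖((Uc b : SU 2) : MatA 2) - 1‖ < min (1 / 2) (α₁ * (F.P K).eta (k + 1) ^ 2 / 8) := by
    intro b
    by_cases hb : b ∈ domBonds F Mc k K X
    · simp only [hUc, if_pos hb]; exact hU b
    · simp only [hUc, if_neg hb]
      have : (((1 : SU 2)) : MatA 2) - 1 = 0 := by simp
      rw [this, norm_zero]; exact hδ
  have hplaq : ∀ p ∈ (Sect2.regionOfSet (F.P K) (Sect2.domSites (F.P K) Mc (k + 1) X)).plaqs,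
      ‖((B12RegularSpaces111.plaq (fun b => ιSU 2 (Uc b)) p : (MatA 2)ˣ) : MatA 2) - 1‖ < α₀ * (F.P K).eta (k + 1) ^ 2 := by
    intro p hpX
    have hcut : (fun b => ιSU 2 (Uc b)) = fun b => if b ∈ domBonds F Mc k K X then recordBgUnits F θ k K B b else 1 := by
      funext b
      by_cases hb : b ∈ domBonds F Mc k K X
      · simp only [hUc, if_pos hb]; rfl
      · simp only [hUc, if_neg hb, map_one]
    rw [hcut, plaq_cut_eq_of_mem_plaqInside F Mc k K X (recordBgUnits F θ k K B) hpX]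
    exact hp p
  have hJtr : ∀ b, (Jc b).trace = 0 := by
    intro b
    by_cases hb : b ∈ domBonds F Mc k K X
    · simp only [hJc, if_pos hb]; exact trace_recordCurrent F θ k K B b
    · simp only [hJc, if_neg hb, Matrix.trace_zero]
  have hJlt : ∀ b, ‖Jc b‖ < α₀ := by
    intro b
    by_cases hb : b ∈ domBonds F Mc k K X
    · simp only [hJc, if_pos hb]; exact hJ b
    · simp only [hJc, if_neg hb, norm_zero]; exact hα₀
  have hSat := satisfies_recordPair F Mc k K X hα₀ hα₁ Uc Jc hUnear hplaq hJtr hJlt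
  rw [encodeCfg_mem_recordUc_iff]
  refine ⟨_, B12RegularSpaces111.mem_space_of_satisfies hSat, ?_⟩
  -- `embedPair ⟨ιSU ∘ Uc, Jc⟩` is the cut pair
  show Sect2.embedPair ⟨fun b => ιSU 2 (Uc b), Jc⟩ = pairCutTorusAt F a₀ ε₂₉ Mc k K X B
  unfold Sect2.embedPair pairCutTorusAt
  refine Prod.ext ?_ ?_
  · funext b
    show ((ιSU 2 (Uc b) : (MatA 2)ˣ) : MatA 2) = _
    by_cases hb : b ∈ domBonds F Mc k K X
    · simp only [hUc, if_pos hb]; rfl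
    · simp only [hUc, if_neg hb, map_one, Units.val_one]
  · funext b
    show Jc b = _
    by_cases hb : b ∈ domBonds F Mc k K X
    · simp only [hJc, if_pos hb]; rfl
    · simp only [hJc, if_neg hb]

/-! ## §3  ★★★ The regularity letter discharged; the domain-wide menu for `stub_FE` down to two letters -/

/-- ★★★ **`CutsInUcNear F` HOLDS FOR EVERY TORUS FAMILY** — from the ⁸ antecedent's own analyticity row `hP9` (the other hypotheses of the antecedent are not read).
[cite: Balaban1987RG1, (1.11)–(1.16) pp.262–263, (1.9) p.261; Balaban1985Variational, Prop. 9 p.309] -/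
theorem cutsInUcNear_holds : ∀ F, CutsInUcNear F := by
  intro F
  refine ⟨0, fun Mc _ j c c₀ c₁ B₃ B₃' a₀ a₁ _ _ _ _ _ _ _ _ _ _ _ hP9 _ ε₂₉ hε α₀ α₁ hα₀ hα₁ k n => ?_⟩
  exact eventually_cutsInUc F a₀ ε₂₉ Mc k n (hP9 k n ε₂₉ hε) hα₀ hα₁

/-- ★★★ **`PortRecordFEHalfBox` (THE REGISTERED STUB's TYPE) FROM THE TWO DOMAIN-WIDE LETTERS** {LZ half (Uc), FE inductive step (Uc)} — the regularity letter being a theorem.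
CONDITIONAL bookkeeping; both letters OPEN. [cite: Balaban1987RG1, Thm 3 p.264, p.268 L27–31, (1.7) p.261] -/
theorem portRecordFEHalfBox_of_lzUc_stepUc (hLZ : ∀ F, PortRecordLZHalfUc F) (hS : ∀ F, FEStepUc F) :
    ∀ F, Summit.QuantumFields.YangMills.Theorems.BalabanUVNodesPortS1.PortRecordFEHalfBox F :=
  portRecordFEHalfBox_of_uc hLZ hS cutsInUcNear_holds

-- standard axioms only
#print axioms cutsInUcNear_holds
#print axioms portRecordFEHalfBox_of_lzUc_stepUc

end Summit.QuantumFields.YangMills.Theorems.BalabanUVNodesPortS1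

end
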